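import Literature.Probability.Percolation.CerfThm13Proofs
import Literature.Probability.Percolation.SiteSharpnessDecay
import Literature.Probability.Percolation.SiteRussoInequality
import HarnessLib

/-!
# Cerf 2015, Theorem 1.1 (the two-arms exponent bound at `p_c`): proof

Topic `Literature/Probability/Percolation`. Sorry-free discharge of the named fact
`Literature.Probability.Percolation.Cerf2015_thm_1_1` (`CerfTwoArms.lean`): for `d ≥ 2` and every
`γ < γ_∞(d) = (2d²+3d−3)/(4d²+5d−5)` there is `c` with `P_{p_c}(two-arms(0,n)) ≤ c n^{−γ}` for
all `n ≥ 1`, `p_c = p_c^site(ℤ^d)`. R. Cerf, *A lower bound on the two-arms exponent for critical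
percolation on the lattice*, Ann. Probab. 43 (2015) 2458–2480, doi:10.1214/14-AOP940
(arXiv:1306.3105; page numbers refer to the 16-page arXiv rendering): Theorem 1.1 (p. 3), proof
in §9 (p. 14) from §§3–8.

## What was missing, and the argument as formalised

All numbered inputs of the printed proof are already proved in the tree, at an arbitrary
parameter `p ∈ (0,1)` (Prop. 4.1, Lemma 5.1, Lemma 7.1, Cor. 7.2: `CerfProp41Proofs`,
`CerfLem51Proofs`, `CerfLem71Proofs`, `CerfCor72Proofs`) or at a parameter with `θ(p) > 0`
(Lemma 6.1, the recursion of §8–§9, the iteration of §9: `CerfLem61Proofs`, `CerfSec8Proofs`,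
`CerfIterationProofs`, assembled in `CerfThm13Proofs` as `Cerf2015_thm_1_1_of_siteTheta_pos_holds`).
The hypothesis `θ(p) > 0` enters these only through the input of Lemma 6.1, a lower bound
`P_p(0 ⟷ b in Λ(m)) ≥ κ/|∂ⁱⁿΛ(m)|` at some inner boundary site `b` of every box. At `p_c` this
input is Cerf's "basic ingredient" (proof of Lemma 6.1, p. 10):
`Σ_{x ∈ ∂ⁱⁿΛ} P_{p_c}(0 ⟷ x in Λ) ≥ 1` for every box `Λ` centred at `0` ("proved in Lemma 3.1 of
[Kozma–Nachmias], or in the proof of theorem 5.3 of [Grimmett, Probability on graphs] … by an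
argument due to Hammersley: if the converse inequality holds, then … the system would be in the
subcritical regime"). We prove it in the Duminil-Copin–Tassion form (site version of
*Enseign. Math.* 62 (2016), Thm. 1.1 item 1, whose one-step inequality for general graphs is
`real_exitEvent_le_dctPhi_mul`, `SiteSharpnessStep.lean`):

* **A.** on `ℤ^d`, `ψ_p(S) < 1` for a finite `S ∋ 0` gives `P_p(0 ⟷ ∂ⁱⁿΛ(kL)) ≤ ψ_p(S)^k`
  (translation invariance + iteration, as in `SiteSharpnessDecay.lean` for `𝕋`), hence
  `θ(p) = 0` (`siteTheta_eq_zero_of_dctPhi_lt_one`);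
* **B.** `q ↦ ψ_q(S)` is continuous on `(0,1)` (a finite sum of polynomials,
  `differentiableAt_sitePercolation_real`);
* **C.** hence for `0 < p_c < 1`, `ψ_{p_c}(S) ≥ 1` for every finite `S ∋ 0`: otherwise `ψ_q(S) < 1`
  for all `q` near `p_c`, while by the definition of `p_c` as an infimum some `q ∈ [p_c, p_c + δ)`
  has `θ(q) > 0` (`one_le_dctPhi_siteCriticalProb`);
* **D.** with `S = Λ(n)`: `ψ_{p_c}(Λ(n)) = Σ_{z ∈ ∂ⁱⁿΛ(n)} P_{p_c}(F_z) ≥ 1`, so some `z ∈ ∂ⁱⁿΛ(n)`,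
  `z ≠ 0`, has `P(F_z) ≥ 1/|∂ⁱⁿΛ(n)|`, and opening `z` (independent of `F_z`, which lives on the
  interior) gives `P_{p_c}(0 ⟷ z in Λ(n)) ≥ p_c/|∂ⁱⁿΛ(n)| ≥ p_c/(2d(2n+1)^{d−1})`
  (`exists_innerBoundary_siteConnIn_ge_criticalProb`; the factor `p_c` only changes constants);
* **E.** Lemma 6.1 from such a point bound with any constant `κ` (`lem_6_1_of_bound`; this is the
  proof of `CerfLem61Proofs.lean` verbatim with `θ(p) ↦ κ`: reflection through a face and
  Harris–FKG, chaining along the coordinates, parity correction);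
* **F.** the recursion of §8–§9 with the connection bound as a hypothesis
  (`sec9_recursion_of_connBound`; the proof of `Cerf2015_sec9_recursion_of_lemmas` verbatim);
* **G.** `Cerf2015_thm_1_1_holds`: at `0 < p_c < 1`, D + E + F and the exponent iteration
  `exponent_iteration` (§9); if `p_c ∈ {0, 1}` (values not excluded by the bare definition
  `siteCriticalProb = inf ({p | θ(p) > 0} ∪ {1})`, where the printed standing assumption
  `p ∈ ]0,1[` fails) the two-arms event is null and the bound holds with `c = 0`.

No new named facts are introduced (D-0026); E and F duplicate two proofs of sibling files with
one hypothesis generalised, rather than editing those landed files.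

## Main results

* `siteTheta_eq_zero_of_dctPhi_lt_one`, `one_le_dctPhi_siteCriticalProb`,
  `exists_innerBoundary_siteConnIn_ge_criticalProb` (the Hammersley / DCT input at `p_c` on `ℤ^d`);
* `lem_6_1_of_bound` (Cerf's Lemma 6.1 from a point bound), `sec9_recursion_of_connBound`;
* `Cerf2015_thm_1_1_holds : Cerf2015_thm_1_1`.

## References

* R. Cerf, Ann. Probab. 43 (2015) 2458–2480, arXiv:1306.3105: Thm 1.1 (p. 3), Lemma 6.1
  (p. 10), §8–§9 (pp. 13–14) [Cerf2015].
* H. Duminil-Copin, V. Tassion, *Enseign. Math.* 62 (2016) 199–206, Thm. 1.1 item 1, §2.1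
  [DuminilCopinTassionEM2016].
* G. Kozma, A. Nachmias, *J. Amer. Math. Soc.* 24 (2011) 375–409, Lemma 3.1 [KozmaNachmias2011].

## Mathlib / tree

Mathlib: `exists_lt_of_csInf_lt`, `csInf_le`, `tendsto_pow_atTop_nhds_zero_of_lt_one`,
`ge_of_tendsto'`, `DifferentiableAt.fun_sum`, `ContinuousAt.preimage_mem_nhds`. Tree: everything
under `CerfThm13Proofs.lean` (Cerf's inputs), `SiteSharpnessStep/Decay.lean` (DCT step, exit
events), `SiteRussoInequality.lean` (differentiability in `p`), `SitePercolationMeasure.lean`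
(disjoint-support independence), `SiteMonotonicity.lean` (`θ ≤ P(exit)`).
-/

noncomputable section

open MeasureTheory Filter Topology Literature.Probability.LatticeModels Literature.Probability.Percolation
open scoped Finset

namespace Literature.Probability.Percolation

section CritPerc

variable {d : ℕ}

/-! ### A. Exponential decay of exit probabilities on `ℤ^d` from `ψ_p(S) < 1` -/

/-- **Translation invariance of one-arm probabilities on `ℤ^d`**:
`P_p(v ⟷ ∂ⁱⁿ(Λ + v) in Λ + v) = P_p(0 ⟷ ∂ⁱⁿΛ in Λ)`. [folklore] -/
theorem zd_real_exitEvent_shift (p : unitInterval) (Λ : Finset (Site d)) (v : Site d) :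
    (sitePercolation (Site d) p).real (exitEvent (zdGraph d) (Λ.image (· + v)) v) =
      (sitePercolation (Site d) p).real (exitEvent (zdGraph d) Λ 0) := by
  have h := sitePercolation_real_exitEvent_iso (zdShiftIso v) p Λ 0
  have h1 : Λ.image (zdShiftIso v) = Λ.image (· + v) := rfl
  have h2 : (zdShiftIso v) 0 = v := by rw [zdShiftIso_apply, zero_add]
  rwa [h1, h2] at h

/-- **One step on `ℤ^d`** (Duminil-Copin–Tassion 2016, §2.1, site version): if `S ⊆ Λ(L)` with
`0` interior to `S` and `L ≤ n`, then `θ_n(p) ≤ ψ_p(S) · θ_{n-L}(p)`, where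
`θ_m(p) = P_p(0 ⟷ ∂ⁱⁿΛ(m) in Λ(m))`. [cite: DuminilCopinTassionEM2016, §2.1 (proof of Thm. 1.1, item 1)] -/
theorem zd_real_exitEvent_box_le (p : unitInterval) {S : Finset (Site d)} {L n : ℕ}
    (hS : S ⊆ box d L) (h0 : (0 : Site d) ∈ siteInterior (zdGraph d) S) (hLn : L ≤ n) :
    (sitePercolation (Site d) p).real (exitEvent (zdGraph d) (box d n) 0) ≤
      dctPhi (zdGraph d) p S 0 *
        (sitePercolation (Site d) p).real (exitEvent (zdGraph d) (box d (n - L)) 0) := by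
  refine real_exitEvent_le_dctPhi_mul p (hS.trans (box_mono d hLn)) h0 fun z hz => ?_
  have hzL : z ∈ box d L := hS ((mem_innerBoundary_iff.1 hz).1)
  have hsub : (box d (n - L)).image (· + z) ⊆ box d n := by
    have := image_add_box_subset (n := n - L) hzL
    rwa [Nat.add_sub_cancel' hLn] at this
  have hz0 : z ∈ (box d (n - L)).image (· + z) :=
    Finset.mem_image.2 ⟨0, zero_mem_box d _, zero_add z⟩
  calc (sitePercolation (Site d) p).real (exitEvent (zdGraph d) (box d n) z)
      ≤ (sitePercolation (Site d) p).real (exitEvent (zdGraph d) ((box d (n - L)).image (· + z)) z) :=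
        measureReal_mono (exitEvent_anti hsub hz0) (measure_ne_top _ _)
    _ = (sitePercolation (Site d) p).real (exitEvent (zdGraph d) (box d (n - L)) 0) :=
        zd_real_exitEvent_shift p _ z

/-- **Exponential decay on `ℤ^d` from `ψ_p(S) < 1`** (Duminil-Copin–Tassion 2016, Thm. 1.1
item 1, §2.1; site version): if `S ⊆ Λ(L)` with `0` interior to `S`, then
`P_p(0 ⟷ ∂ⁱⁿΛ(n) in Λ(n)) ≤ ψ_p(S)^k` for `n ≥ kL`. [cite: DuminilCopinTassionEM2016, Thm. 1.1 item 1, §2.1] -/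
theorem zd_real_exitEvent_box_le_dctPhi_pow (p : unitInterval) {S : Finset (Site d)} {L : ℕ}
    (hS : S ⊆ box d L) (h0 : (0 : Site d) ∈ siteInterior (zdGraph d) S) (k : ℕ) {n : ℕ}
    (hn : k * L ≤ n) :
    (sitePercolation (Site d) p).real (exitEvent (zdGraph d) (box d n) 0) ≤
      dctPhi (zdGraph d) p S 0 ^ k := by
  induction k generalizing n with
  | zero => simp [measureReal_le_one]
  | succ k ih =>
    have hLn : L ≤ n := le_trans (by nlinarith) hn
    have hk : k * L ≤ n - L := by
      rw [Nat.succ_mul] at hn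
      omega
    calc (sitePercolation (Site d) p).real (exitEvent (zdGraph d) (box d n) 0)
        ≤ dctPhi (zdGraph d) p S 0 *
            (sitePercolation (Site d) p).real (exitEvent (zdGraph d) (box d (n - L)) 0) :=
          zd_real_exitEvent_box_le p hS h0 hLn
      _ ≤ dctPhi (zdGraph d) p S 0 * dctPhi (zdGraph d) p S 0 ^ k :=
          mul_le_mul_of_nonneg_left (ih hk) (dctPhi_nonneg p S 0)
      _ = dctPhi (zdGraph d) p S 0 ^ (k + 1) := by ring

/-- **`ψ_p(S) < 1` for some finite `S ∋ 0` forces `θ(p) = 0` on `ℤ^d`** (Duminil-Copin–Tassion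
2016, Thm. 1.1 item 1: exponential decay, hence no percolation): `θ(p) ≤ P_p(0 ⟷ ∂ⁱⁿΛ(kL))
≤ ψ_p(S)^k → 0`. [cite: DuminilCopinTassionEM2016, Thm. 1.1 item 1] -/
theorem siteTheta_eq_zero_of_dctPhi_lt_one (p : unitInterval) {S : Finset (Site d)}
    (h0S : (0 : Site d) ∈ S) (hψ : dctPhi (zdGraph d) p S 0 < 1) :
    siteTheta (zdGraph d) 0 p = 0 := by
  -- `0` is interior to `S`, for otherwise `ψ_p(S) ≥ 1`
  have h0 : (0 : Site d) ∈ siteInterior (zdGraph d) S := by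
    by_contra h
    exact absurd hψ (not_lt.2 (one_le_dctPhi_of_mem_innerBoundary p
      (mem_innerBoundary_of_not_mem_siteInterior h0S h)))
  -- `S` lies in some box `Λ(L)`
  obtain ⟨L, hS⟩ : ∃ L : ℕ, S ⊆ box d L := by
    choose f hf using fun z : Site d => exists_mem_box z
    exact ⟨S.sup f, fun z hz => box_mono d (Finset.le_sup hz) (hf z)⟩
  set c := dctPhi (zdGraph d) p S 0 with hc
  have hc0 : 0 ≤ c := dctPhi_nonneg p S 0
  have hle : ∀ k : ℕ, siteTheta (zdGraph d) 0 p ≤ c ^ k := fun k =>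
    calc siteTheta (zdGraph d) 0 p
        ≤ (sitePercolation (Site d) p).real (exitEvent (zdGraph d) (box d (k * L)) 0) :=
          measureReal_mono (sitePercolatesAt_subset_exitEvent (zero_mem_box d _))
            (measure_ne_top _ _)
      _ ≤ c ^ k := zd_real_exitEvent_box_le_dctPhi_pow p hS h0 k le_rfl
  have hlim : Tendsto (fun k : ℕ => c ^ k) atTop (𝓝 0) :=
    tendsto_pow_atTop_nhds_zero_of_lt_one hc0 hψ
  have hθ0 : 0 ≤ siteTheta (zdGraph d) 0 p := measureReal_nonneg
  exact le_antisymm (ge_of_tendsto' hlim hle) hθ0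

/-! ### B. Continuity of `q ↦ ψ_q(S)` on `(0, 1)` -/

/-- `q ↦ ψ_q(S)` (real parameter clamped to `[0,1]`) is continuous at every `p ∈ (0,1)`: a
finite sum of probabilities of local events, each a polynomial in `q`
(`differentiableAt_sitePercolation_real`). [folklore] -/
theorem continuousAt_dctPhi {V : Type*} (G : SimpleGraph V) [DecidableEq V] [G.LocallyFinite]
    (S : Finset V) (x : V) {p : ℝ} (hp : p ∈ Set.Ioo (0 : ℝ) 1) :
    ContinuousAt (fun q : ℝ => dctPhi G (Set.projIcc 0 1 zero_le_one q) S x) p := by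
  unfold dctPhi
  have h : ∀ z ∈ innerBoundary G S, DifferentiableAt ℝ
      (fun q : ℝ => (sitePercolation V (Set.projIcc 0 1 zero_le_one q)).real (dctEvent G S x z)) p :=
    fun z _ => differentiableAt_sitePercolation_real (siteInterior G S)
      (determinedBy_dctEvent S x z) hp
  exact (DifferentiableAt.fun_sum h).continuousAt

/-! ### C. At `p_c`, `ψ_{p_c}(S) ≥ 1` for every finite `S ∋ 0` (Hammersley / DCT) -/

/-- **`ψ_{p_c}(S) ≥ 1` for all finite `S ∋ 0`, when `0 < p_c < 1`** (Duminil-Copin–Tassion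
2016, Thm. 1.1 and the definition of `p̃_c`; classically Hammersley 1957 / Kozma–Nachmias 2011
Lemma 3.1 in the form `Σ_{x ∈ ∂Λ} P_{p_c}(0 ⟷ x in Λ) ≥ 1`, cf. Cerf 2015, proof of Lemma 6.1):
otherwise, by continuity, `ψ_q(S) < 1` for `q` slightly above `p_c`, and some such `q` has
`θ(q) > 0` (definition of `p_c` as an infimum), contradicting
`siteTheta_eq_zero_of_dctPhi_lt_one`. [cite: Cerf2015, Lem 6.1 (proof, first display)] -/
theorem one_le_dctPhi_siteCriticalProb (hpc0 : 0 < (siteCriticalProbI d : ℝ))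
    (hpc1 : (siteCriticalProbI d : ℝ) < 1) {S : Finset (Site d)} (h0S : (0 : Site d) ∈ S) :
    1 ≤ dctPhi (zdGraph d) (siteCriticalProbI d) S 0 := by
  by_contra hlt
  rw [not_le] at hlt
  set pc : ℝ := (siteCriticalProbI d : ℝ) with hpc
  have hpcI : pc ∈ Set.Ioo (0 : ℝ) 1 := ⟨hpc0, hpc1⟩
  -- continuity: `ψ_q(S) < 1` for `q` near `p_c`
  have hcont := continuousAt_dctPhi (zdGraph d) S (0 : Site d) hpcI
  have hproj : Set.projIcc 0 1 zero_le_one pc = siteCriticalProbI d := by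
    rw [hpc, Set.projIcc_val]
  have hev : ∀ᶠ q in 𝓝 pc, dctPhi (zdGraph d) (Set.projIcc 0 1 zero_le_one q) S 0 < 1 :=
    hcont.preimage_mem_nhds (Iio_mem_nhds (by rwa [hproj]))
  obtain ⟨δ, hδ, hball⟩ := Metric.eventually_nhds_iff.1 hev
  -- the set whose infimum is `p_c`
  set T : Set ℝ := {q : ℝ | ∃ h : q ∈ unitInterval, 0 < siteTheta (zdGraph d) (0 : Site d) ⟨q, h⟩} ∪ {1}
    with hT
  have hTdef : siteCriticalProb (zdGraph d) (0 : Site d) = sInf T := rfl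
  have hTne : T.Nonempty := ⟨1, Or.inr rfl⟩
  have hTbdd : BddBelow T := ⟨0, by
    rintro q (⟨hq, -⟩ | hq)
    · exact hq.1
    · rw [Set.mem_singleton_iff] at hq; rw [hq]; exact zero_le_one⟩
  have hpcT : pc = sInf T := by rw [hpc, coe_siteCriticalProbI]; rfl
  -- pick `q ∈ T` with `p_c ≤ q < min (p_c + δ) 1`
  have hlt' : sInf T < min (pc + δ) 1 := by
    rw [← hpcT]; exact lt_min (by linarith) hpc1
  obtain ⟨q, hqT, hqlt⟩ := exists_lt_of_csInf_lt hTne hlt'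
  have hq1 : q < 1 := hqlt.trans_le (min_le_right _ _)
  have hqδ : q < pc + δ := hqlt.trans_le (min_le_left _ _)
  have hpcq : pc ≤ q := by rw [hpcT]; exact csInf_le hTbdd hqT
  rcases hqT with ⟨hqI, hθq⟩ | hq
  · -- `ψ_q(S) < 1`, hence `θ(q) = 0`: contradiction
    have hdist : dist q pc < δ := by
      rw [Real.dist_eq, abs_lt]; constructor <;> linarith
    have hψq := hball hdist
    rw [Set.projIcc_of_mem _ hqI] at hψq
    have := siteTheta_eq_zero_of_dctPhi_lt_one ⟨q, hqI⟩ h0S hψq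
    rw [this] at hθq
    exact lt_irrefl _ hθq
  · rw [Set.mem_singleton_iff] at hq
    exact absurd hq hq1.ne

/-! ### D. The point-to-boundary-site lower bound at `p_c` -/

/-- The origin is not an inner boundary site of `Λ(n)` for `n ≥ 1`. [folklore] -/
theorem zero_not_mem_innerBoundary_box {n : ℕ} (hn : 1 ≤ n) :
    (0 : Site d) ∉ innerBoundary (zdGraph d) (box d n) := by
  intro h
  obtain ⟨-, y, hy, h0y⟩ := mem_innerBoundary_iff.1 h
  apply hy
  rw [zdGraph_adj_iff] at h0y
  obtain ⟨i, hi⟩ := h0y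
  rw [mem_box]
  intro j
  rcases hi with hi | hi
  · rw [hi]
    by_cases hij : j = i
    · subst hij; simp; omega
    · simp [Pi.single_eq_of_ne hij]
  · have hy' : y = -Pi.single i 1 := by
      have : (0 : Site d) = y + Pi.single i 1 := hi
      exact eq_neg_of_add_eq_zero_left this.symm
    rw [hy']
    by_cases hij : j = i
    · subst hij; simp; omega
    · simp [Pi.single_eq_of_ne hij]

/-- **The Hammersley input at `p_c`** (Cerf 2015, proof of Lemma 6.1, p. 10: "there exists `x*`
in `∂ⁱⁿΛ(n)` such that `P_{p_c}(0 ⟷ x* in Λ(n)) ≥ 1/|∂ⁱⁿΛ(n)| ≥ 1/((2d)(2n+1)^{d−1})`"; here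
with the harmless extra factor `p_c`, from `ψ_{p_c}(Λ(n)) ≥ 1` by pigeonhole and by opening the
boundary site): for `0 < p_c < 1` and `n ≥ 1` some `b ∈ ∂ⁱⁿΛ(n)` has
`P_{p_c}(0 ⟷ b in Λ(n)) ≥ p_c/(2d(2n+1)^{d−1})`. [cite: Cerf2015, Lem 6.1 (proof)] -/
theorem exists_innerBoundary_siteConnIn_ge_criticalProb (hpc0 : 0 < (siteCriticalProbI d : ℝ))
    (hpc1 : (siteCriticalProbI d : ℝ) < 1) {n : ℕ} (hn : 1 ≤ n) :
    ∃ b ∈ innerBoundary (zdGraph d) (box d n),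
      (siteCriticalProbI d : ℝ) / (2 * d * (2 * n + 1) ^ (d - 1)) ≤
        (sitePercolation (Site d) (siteCriticalProbI d)).real
          (siteConnIn (zdGraph d) ↑(box d n) 0 b) := by
  classical
  set p := siteCriticalProbI d with hp
  set μ := sitePercolation (Site d) p with hμ
  set B := innerBoundary (zdGraph d) (box d n) with hB
  have hψ : 1 ≤ ∑ z ∈ B, μ.real (dctEvent (zdGraph d) (box d n) 0 z) :=
    one_le_dctPhi_siteCriticalProb hpc0 hpc1 (zero_mem_box d n)
  -- pigeonhole: some boundary site carries at least the average
  have hBne : B.Nonempty := by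
    rw [Finset.nonempty_iff_ne_empty]
    rintro h
    rw [h, Finset.sum_empty] at hψ
    exact absurd hψ (by norm_num)
  have hcard_pos : (0 : ℝ) < B.card := by exact_mod_cast hBne.card_pos
  have hsum : ∑ _z ∈ B, (1 : ℝ) / B.card ≤ ∑ z ∈ B, μ.real (dctEvent (zdGraph d) (box d n) 0 z) := by
    rw [Finset.sum_const, nsmul_eq_mul, mul_one_div_cancel hcard_pos.ne']
    exact hψ
  obtain ⟨z, hz, hzP⟩ := Finset.exists_le_of_sum_le hBne hsum
  refine ⟨z, hz, ?_⟩
  have hz0 : z ≠ 0 := fun h => zero_not_mem_innerBoundary_box hn (h ▸ hz)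
  have hzbox : z ∈ box d n := (mem_innerBoundary_iff.1 hz).1
  -- the event `F_z(Λ(n))` is `{∃ w ∼ z, 0 ⟷ w in I(Λ(n))}`; glue with `{z open}`
  set I := siteInterior (zdGraph d) (box d n) with hI
  have hzI : z ∉ I := not_mem_siteInterior_of_mem_innerBoundary subset_rfl hz
  have hsub : dctEvent (zdGraph d) (box d n) 0 z ∩ {ω | z ∈ ω} ⊆
      siteConnIn (zdGraph d) ↑(box d n) 0 z := by
    rintro ω ⟨hF, hzω⟩
    rcases hF with h | ⟨w, hzw, hw⟩
    · exact absurd h hz0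
    · have hIbox : (↑I : Set (Site d)) ⊆ ↑(box d n) :=
        Finset.coe_subset.2 (siteInterior_subset (box d n))
      have hw' := hw
      obtain ⟨-, hwω, -, hwI, -⟩ := hw'
      have hwbox : w ∈ (↑(box d n) : Set (Site d)) := hIbox hwI
      have h2 : ω ∈ siteConnIn (zdGraph d) ↑(box d n) w z :=
        mem_siteConnIn_of_adj _ hwω hzω hwbox (Finset.mem_coe.2 hzbox) hzw.symm
      exact siteConnIn_trans _ hIbox subset_rfl hw h2
  have hind : μ.real (dctEvent (zdGraph d) (box d n) 0 z ∩ {ω | z ∈ ω}) =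
      μ.real (dctEvent (zdGraph d) (box d n) 0 z) * μ.real {ω | z ∈ ω} := by
    refine sitePercolation_real_inter_of_disjoint p (determinedBy_dctEvent (box d n) 0 z)
      (G := ({z} : Finset (Site d))) (by simpa using determinedBy_mem z) ?_
    exact Finset.disjoint_singleton_right.2 hzI
  rw [sitePercolation_real_mem] at hind
  have hcardle : (B.card : ℝ) ≤ 2 * d * (2 * n + 1) ^ (d - 1) := by
    exact_mod_cast card_innerBoundary_box_le (d := d) n
  have hp0 : (0 : ℝ) ≤ p := p.2.1
  calc (p : ℝ) / (2 * d * (2 * n + 1) ^ (d - 1))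
      ≤ (p : ℝ) / B.card := div_le_div_of_nonneg_left hp0 hcard_pos hcardle
    _ = 1 / B.card * p := by ring
    _ ≤ μ.real (dctEvent (zdGraph d) (box d n) 0 z) * p :=
        mul_le_mul_of_nonneg_right hzP hp0
    _ = μ.real (dctEvent (zdGraph d) (box d n) 0 z ∩ {ω | z ∈ ω}) := hind.symm
    _ ≤ μ.real (siteConnIn (zdGraph d) ↑(box d n) 0 z) :=
        measureReal_mono hsub (measure_ne_top _ _)

/-! ### E. Lemma 6.1 from a point-to-boundary-site bound (Cerf 2015, §6, verbatim) -/

/-- **Even axis points** (Cerf 2015, proof of Lemma 6.1, p. 10: "`P_{p_c}(0 ⟷ 2ne_1 in Λ(n) ∪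
(2ne_1 + Λ(n))) ≥ … ≥ (1/((2d)(2n+1)^{d−1}))²`"), from a bound
`P(0 ⟷ b in Λ(m)) ≥ κ/(2d(2m+1)^{d−1})` at some `b ∈ ∂ⁱⁿΛ(m)`: a signed coordinate permutation
moves `b` to the face `{x_j = s m}`, the reflection in that face maps `Λ(m)` to `2sm e_j + Λ(m)`
fixing the moved point, and Harris–FKG glues the two connections. (This is `axis_two_boxes` of
`CerfLem61Proofs.lean` with the input `θ(p)/|∂ⁱⁿΛ(m)|` replaced by an arbitrary `κ`.)
[cite: Cerf2015, Lem 6.1 (proof)] -/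
theorem axis_two_boxes_of_bound (p : unitInterval) {κ : ℝ} (hκ0 : 0 ≤ κ) (m : ℕ)
    (hbd : ∃ b ∈ innerBoundary (zdGraph d) (box d m),
      κ / (2 * d * (2 * m + 1) ^ (d - 1)) ≤
        (sitePercolation (Site d) p).real (siteConnIn (zdGraph d) ↑(box d m) 0 b))
    (j : Fin d) (s : ℤˣ) :
    (κ / (2 * d * (2 * m + 1) ^ (d - 1))) ^ 2 ≤
      (sitePercolation (Site d) p).real (siteConnIn (zdGraph d)
        ↑(box d m ∪ (box d m).image (· + Pi.single j ((s : ℤ) * (2 * m))))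
        0 (Pi.single j ((s : ℤ) * (2 * m)))) := by
  set μ := sitePercolation (Site d) p with hμ
  obtain ⟨b, hb, hq⟩ := hbd
  have hq0 : 0 ≤ κ / (2 * d * (2 * m + 1) ^ (d - 1)) := div_nonneg hκ0 (by positivity)
  -- move `b` to the face `{x_j = s m}` by a signed coordinate permutation
  obtain ⟨i, hi⟩ := exists_eq_of_mem_innerBoundary_box hb
  obtain ⟨t, ht⟩ : ∃ t : ℤˣ, (t : ℤ) * b i = (s : ℤ) * m := by
    rcases hi with h | h
    · exact ⟨s, by rw [h]⟩
    · exact ⟨-s, by rw [h, Units.val_neg]; ring⟩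
  set x' : Site d := Site.signedPerm (Equiv.swap i j) (fun _ => t) b with hx'
  have hx'j : x' j = (s : ℤ) * m := by
    rw [hx', Site.signedPerm_apply, Equiv.symm_swap, Equiv.swap_apply_right]; exact ht
  have hsym : μ.real (siteConnIn (zdGraph d) ↑(box d m) 0 x') =
      μ.real (siteConnIn (zdGraph d) ↑(box d m) 0 b) :=
    real_siteConnIn_signedPerm p m _ _ b
  -- reflect through the face and glue
  have hrefl := real_siteConnIn_reflect p m x' j
  have h2 : 2 * x' j = (s : ℤ) * (2 * m) := by rw [hx'j]; ring
  rw [h2] at hrefl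
  set v : Site d := Pi.single j ((s : ℤ) * (2 * m)) with hv
  have hS : box d m ⊆ box d m ∪ (box d m).image (· + v) := Finset.subset_union_left
  have hS' : (box d m).image (· + v) ⊆ box d m ∪ (box d m).image (· + v) :=
    Finset.subset_union_right
  have hglue := real_siteConnIn_mul_le (zdGraph d) p hS hS' 0 x' v
  rw [hrefl, hsym] at hglue
  calc (κ / (2 * d * (2 * m + 1) ^ (d - 1))) ^ 2
      = (κ / (2 * d * (2 * m + 1) ^ (d - 1))) * (κ / (2 * d * (2 * m + 1) ^ (d - 1))) := sq _
    _ ≤ μ.real (siteConnIn (zdGraph d) ↑(box d m) 0 b) *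
          μ.real (siteConnIn (zdGraph d) ↑(box d m) 0 b) :=
        mul_le_mul hq hq hq0 measureReal_nonneg
    _ ≤ _ := hglue

/-- **Chaining along the coordinates** (Cerf 2015, proof of Lemma 6.1, p. 10: "We suppose
first that `y_i − x_i` is even … by the FKG inequality,
`P(x ⟷ y in Λ(2n)) ≥ Π_i P(z_i ⟷ z_{i+1} in Λ(2n))` … `(z_i + Λ(n_i)) ∪ (z_{i+1} + Λ(n_i)) ⊆
Λ(2n)`"): for `x, y ∈ Λ(n)` with all coordinate differences even,
`P(x ⟷ y in Λ(2n)) ≥ p · ρ_n^d` with `ρ_n = min(p, (κ/(2d(2n+1)^{d−1}))²)`, given the point bound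
with constant `κ` at every scale `m ≥ 1` (`chain_even` of `CerfLem61Proofs.lean` with `θ ↦ κ`).
[cite: Cerf2015, Lem 6.1 (proof)] -/
theorem chain_even_of_bound (p : unitInterval) {κ : ℝ} (hκ0 : 0 ≤ κ)
    (hκ : ∀ m : ℕ, 1 ≤ m → ∃ b ∈ innerBoundary (zdGraph d) (box d m),
      κ / (2 * d * (2 * m + 1) ^ (d - 1)) ≤
        (sitePercolation (Site d) p).real (siteConnIn (zdGraph d) ↑(box d m) 0 b))
    {n : ℕ} {x y : Site d} (hx : x ∈ box d n) (hy : y ∈ box d n)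
    (heven : ∀ i, Even (y i - x i)) :
    (p : ℝ) * (min (p : ℝ) ((κ / (2 * d * (2 * n + 1) ^ (d - 1))) ^ 2)) ^ d ≤
      (sitePercolation (Site d) p).real (siteConnIn (zdGraph d) ↑(box d (2 * n)) x y) := by
  set μ := sitePercolation (Site d) p with hμ
  set ρ : ℝ := min (p : ℝ) ((κ / (2 * d * (2 * n + 1) ^ (d - 1))) ^ 2) with hρ
  have hp0 : (0 : ℝ) ≤ p := p.2.1
  have hp1 : (p : ℝ) ≤ 1 := p.2.2
  have hρ0 : 0 ≤ ρ := le_min hp0 (sq_nonneg _)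
  have hρ1 : ρ ≤ 1 := (min_le_left _ _).trans hp1
  have hn2 : n ≤ 2 * n := by omega
  -- induction over the set of coordinates already adjusted
  suffices H : ∀ S : Finset (Fin d), (p : ℝ) * ρ ^ S.card ≤
      μ.real (siteConnIn (zdGraph d) ↑(box d (2 * n)) x (S.piecewise y x)) by
    have := H Finset.univ
    rwa [Finset.card_univ, Fintype.card_fin, Finset.piecewise_univ] at this
  intro S
  induction S using Finset.induction_on with
  | empty =>
    rw [Finset.card_empty, pow_zero, mul_one, Finset.piecewise_empty,
      siteConnIn_self_eq (zdGraph d) (Finset.mem_coe.2 (box_mono d hn2 hx)),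
      sitePercolation_real_mem]
  | insert j S hj ih =>
    set w := S.piecewise y x with hw
    have hwB : w ∈ box d n := piecewise_mem_box hx hy S
    have hw'B : (insert j S).piecewise y x ∈ box d n := piecewise_mem_box hx hy _
    have hstep : (insert j S).piecewise y x = w + Pi.single j (y j - x j) :=
      piecewise_insert_eq x y S hj
    rw [Finset.card_insert_of_notMem hj, pow_succ, ← mul_assoc]
    -- write `y j - x j = t (2 m)`
    obtain ⟨k, hk⟩ := heven j
    obtain ⟨t, m, htm⟩ : ∃ (t : ℤˣ) (m : ℕ), k = (t : ℤ) * m := by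
      rcases Int.natAbs_eq k with h | h
      · exact ⟨1, k.natAbs, by simpa using h⟩
      · exact ⟨-1, k.natAbs, by simpa using h⟩
    have hv : y j - x j = (t : ℤ) * (2 * m) := by rw [hk, htm]; ring
    have hmn : m ≤ n := by
      have h1 := (mem_box.1 hx) j
      have h2 := (mem_box.1 hy) j
      have h3 : |y j - x j| ≤ 2 * n := by rw [abs_le]; omega
      rw [hv, abs_mul] at h3
      have h4 : |((t : ℤ))| = 1 := by
        rcases Int.units_eq_one_or t with h | h <;> simp [h]
      rw [h4, one_mul] at h3
      have h5 : |(2 * (m : ℤ))| = 2 * m := abs_of_nonneg (by positivity)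
      rw [h5] at h3
      omega
    rcases Nat.eq_zero_or_pos m with hm0 | hm0
    · -- no move
      have h0 : y j - x j = 0 := by rw [hv, hm0]; simp
      rw [hstep, h0, Pi.single_zero, add_zero]
      calc (p : ℝ) * ρ ^ S.card * ρ ≤ (p : ℝ) * ρ ^ S.card * 1 := by gcongr
        _ = (p : ℝ) * ρ ^ S.card := mul_one _
        _ ≤ _ := ih
    · -- the two-box connection at scale `m`, translated to `w`, inside `Λ(2n)`
      set v : Site d := Pi.single j ((t : ℤ) * (2 * m)) with hvdef
      have hax := axis_two_boxes_of_bound p hκ0 m (hκ m hm0) j t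
      rw [← real_siteConnIn_translate p _ w v] at hax
      have hsub : (box d m ∪ (box d m).image (· + v)).image (· + w) ⊆ box d (2 * n) := by
        rw [Finset.image_union]
        apply Finset.union_subset (image_add_box_subset_two_mul hmn hwB)
        rw [Finset.image_image]
        have hcomp : ((· + w) ∘ (· + v) : Site d → Site d) = (· + (w + v)) := by
          funext z; simp only [Function.comp_apply]; abel
        rw [hcomp]
        apply image_add_box_subset_two_mul hmn
        rw [hvdef, ← hv, ← hstep]; exact hw'B
      have hglue := real_siteConnIn_mul_le (zdGraph d) p (subset_refl (box d (2 * n))) hsub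
        x w (v + w)
      have hvw : v + w = (insert j S).piecewise y x := by rw [hstep, hvdef, hv, add_comm]
      rw [hvw] at hglue hax
      -- `ρ ≤ (κ/(2d(2m+1)^{d-1}))²`
      have hρm : ρ ≤ (κ / (2 * d * (2 * m + 1) ^ (d - 1))) ^ 2 := by
        refine (min_le_right _ _).trans ?_
        have hd0 : 0 < d := Fin.pos j
        have h1 : κ / (2 * d * (2 * n + 1) ^ (d - 1)) ≤ κ / (2 * d * (2 * m + 1) ^ (d - 1)) := by
          apply div_le_div_of_nonneg_left hκ0 (by positivity)
          have : (2 * (m : ℝ) + 1) ≤ 2 * n + 1 := by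
            have : (m : ℝ) ≤ n := by exact_mod_cast hmn
            linarith
          gcongr
        have h0 : 0 ≤ κ / (2 * d * (2 * n + 1) ^ (d - 1)) := div_nonneg hκ0 (by positivity)
        exact pow_le_pow_left₀ h0 h1 2
      calc (p : ℝ) * ρ ^ S.card * ρ
          ≤ μ.real (siteConnIn (zdGraph d) ↑(box d (2 * n)) x w) *
              (κ / (2 * d * (2 * m + 1) ^ (d - 1))) ^ 2 :=
            mul_le_mul ih hρm hρ0 measureReal_nonneg
        _ ≤ μ.real (siteConnIn (zdGraph d) ↑(box d (2 * n)) x w) *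
              μ.real (siteConnIn (zdGraph d)
                ↑((box d m ∪ (box d m).image (· + v)).image (· + w)) w
                  ((insert j S).piecewise y x)) :=
            mul_le_mul_of_nonneg_left hax measureReal_nonneg
        _ ≤ _ := hglue

/-- **Cerf 2015, Lemma 6.1 from the point bound**: for `d ≥ 2`, `p > 0` and a constant
`0 < κ ≤ 1` with `∀ m ≥ 1 ∃ b ∈ ∂ⁱⁿΛ(m), P_p(0 ⟷ b in Λ(m)) ≥ κ/(2d(2m+1)^{d−1})`, there is
`c > 0` (namely `c = p^{d+2} (p κ²/(4d² 9^{d−1}))^d`) with `P_p(x ⟷ y in Λ(2n)) ≥ c/n^{2(d−1)d}`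
for all `n ≥ 1`, `x, y ∈ Λ(n)` (§6, p. 10: the parity correction "`|z_i − y_i| ≤ 1`, `z_i − x_i`
even … the probability of connection between `z` and `y` is larger than `p_c^d`" and the
assembly; `Cerf2015_lem_6_1_of_siteTheta_pos_holds` with `θ ↦ κ`). At `p_c` the point bound is
`exists_innerBoundary_siteConnIn_ge_criticalProb` (`κ = p_c`), which gives Lemma 6.1 as printed.
[cite: Cerf2015, Lem 6.1] -/
theorem lem_6_1_of_bound (hd : 2 ≤ d) (p : unitInterval) (hp0 : 0 < (p : ℝ)) {κ : ℝ}
    (hκpos : 0 < κ) (hκ1 : κ ≤ 1)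
    (hκ : ∀ m : ℕ, 1 ≤ m → ∃ b ∈ innerBoundary (zdGraph d) (box d m),
      κ / (2 * d * (2 * m + 1) ^ (d - 1)) ≤
        (sitePercolation (Site d) p).real (siteConnIn (zdGraph d) ↑(box d m) 0 b)) :
    ∃ c : ℝ, 0 < c ∧ ∀ n : ℕ, 1 ≤ n → ∀ x ∈ box d n, ∀ y ∈ box d n,
      c / (n : ℝ) ^ (2 * (d - 1) * d) ≤
        (sitePercolation (Site d) p).real (siteConnIn (zdGraph d) ↑(box d (2 * n)) x y) := by
  set μ := sitePercolation (Site d) p with hμ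
  have hp1 : (p : ℝ) ≤ 1 := p.2.2
  have hd0 : (0 : ℝ) < d := by exact_mod_cast (show 0 < d by omega)
  obtain ⟨c₀, hc₀⟩ : ∃ c : ℝ, c = (p : ℝ) * κ ^ 2 / (4 * (d : ℝ) ^ 2 * 9 ^ (d - 1)) := ⟨_, rfl⟩
  have hc₀pos : 0 < c₀ := by rw [hc₀]; positivity
  refine ⟨(p : ℝ) ^ (d + 2) * c₀ ^ d, by positivity, fun n hn x hx y hy => ?_⟩
  have hn0 : (0 : ℝ) < n := by exact_mod_cast (show 0 < n by omega)
  have hn1 : (1 : ℝ) ≤ n := by exact_mod_cast hn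
  -- the intermediate point `z`
  set z : Site d := fun i => if Even (y i - x i) then y i
    else if y i < n then y i + 1 else y i - 1 with hz
  have hzB : z ∈ box d n := by
    rw [mem_box] at hy ⊢
    intro i
    have h := hy i
    simp only [hz]
    split_ifs with h1 h2 <;> omega
  have hzeven : ∀ i, Even (z i - x i) := by
    intro i
    by_cases h1 : Even (y i - x i)
    · have e : z i = y i := by simp [hz, h1]
      rw [e]; exact h1
    · have h1' : Odd (y i - x i) := Int.not_even_iff_odd.mp h1
      by_cases h2 : y i < n
      · have e : z i = y i + 1 := by simp [hz, h1, h2]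
        rw [e, show y i + 1 - x i = (y i - x i) + 1 by ring]
        exact h1'.add_one
      · have e : z i = y i - 1 := by simp [hz, h1, h2]
        rw [e, show y i - 1 - x i = (y i - x i) - 1 by ring]
        exact h1'.sub_odd odd_one
  have hnear : ∀ i, z i = y i ∨ z i = y i + 1 ∨ y i = z i + 1 := by
    intro i
    simp only [hz]
    split_ifs with h1 h2
    · exact Or.inl rfl
    · exact Or.inr (Or.inl rfl)
    · exact Or.inr (Or.inr (by ring))
  -- the two legs
  have hleg1 := chain_even_of_bound p hκpos.le hκ hx hzB hzeven
  have hleg2 := near_points p hy hzB hnear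
  have hglue := real_siteConnIn_mul_le (zdGraph d) p (subset_refl (box d (2 * n)))
    (subset_refl (box d (2 * n))) x z y
  -- `ρ_n ≥ c₀ / n^{2(d-1)}`
  set ρ : ℝ := min (p : ℝ) ((κ / (2 * d * (2 * n + 1) ^ (d - 1))) ^ 2) with hρ
  have hρ0 : 0 ≤ ρ := le_min hp0.le (sq_nonneg _)
  have ht1 : (κ / (2 * d * (2 * n + 1) ^ (d - 1))) ^ 2 ≤ 1 := by
    have h1 : (1 : ℝ) ≤ 2 * d * (2 * n + 1) ^ (d - 1) := by
      have h2 : (1 : ℝ) ≤ (2 * n + 1) ^ (d - 1) := one_le_pow₀ (by linarith)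
      have h3 : (1 : ℝ) ≤ 2 * d := by
        have : (1 : ℝ) ≤ d := by exact_mod_cast (show 1 ≤ d by omega)
        linarith
      nlinarith
    have h4 : κ / (2 * d * (2 * n + 1) ^ (d - 1)) ≤ 1 := by
      rw [div_le_one (by positivity)]; linarith
    have h5 : 0 ≤ κ / (2 * d * (2 * n + 1) ^ (d - 1)) := div_nonneg hκpos.le (by positivity)
    exact pow_le_one₀ h5 h4
  have hρc : c₀ / (n : ℝ) ^ (2 * (d - 1)) ≤ ρ := by
    have h1 : (p : ℝ) * (κ / (2 * d * (2 * n + 1) ^ (d - 1))) ^ 2 ≤ ρ :=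
      mul_le_min_of_le_one hp0.le hp1 (sq_nonneg _) ht1
    refine le_trans ?_ h1
    -- `c₀/n^{2(d-1)} ≤ p (κ/(2d(2n+1)^{d-1}))²` since `2n+1 ≤ 3n`
    have h2 : (2 * (n : ℝ) + 1) ^ (d - 1) ≤ (3 * (n : ℝ)) ^ (d - 1) :=
      pow_le_pow_left₀ (by positivity) (by linarith) _
    have h3 : (p : ℝ) * (κ / (2 * d * (2 * n + 1) ^ (d - 1))) ^ 2 =
        (p : ℝ) * κ ^ 2 / (4 * (d : ℝ) ^ 2 * ((2 * (n : ℝ) + 1) ^ (d - 1)) ^ 2) := by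
      rw [div_pow]; ring
    have h4 : c₀ / (n : ℝ) ^ (2 * (d - 1)) =
        (p : ℝ) * κ ^ 2 / (4 * (d : ℝ) ^ 2 * ((3 * (n : ℝ)) ^ (d - 1)) ^ 2) := by
      have e1 : ((3 * (n : ℝ)) ^ (d - 1)) ^ 2 = 9 ^ (d - 1) * (n : ℝ) ^ (2 * (d - 1)) := by
        rw [← pow_mul, mul_pow, mul_comm (d - 1) 2, pow_mul (3 : ℝ) 2 (d - 1)]
        norm_num
      rw [e1, hc₀]
      field_simp
    rw [h3, h4]
    apply div_le_div_of_nonneg_left (by positivity) (by positivity)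
    gcongr
  -- assemble
  have hmain : (p : ℝ) ^ (d + 2) * c₀ ^ d / (n : ℝ) ^ (2 * (d - 1) * d) ≤
      ((p : ℝ) * ρ ^ d) * (p : ℝ) ^ (d + 1) := by
    have h1 : c₀ ^ d / (n : ℝ) ^ (2 * (d - 1) * d) = (c₀ / (n : ℝ) ^ (2 * (d - 1))) ^ d := by
      rw [div_pow, ← pow_mul]
    have h2 : (c₀ / (n : ℝ) ^ (2 * (d - 1))) ^ d ≤ ρ ^ d :=
      pow_le_pow_left₀ (by positivity) hρc d
    calc (p : ℝ) ^ (d + 2) * c₀ ^ d / (n : ℝ) ^ (2 * (d - 1) * d)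
        = (p : ℝ) ^ (d + 2) * (c₀ / (n : ℝ) ^ (2 * (d - 1))) ^ d := by rw [mul_div_assoc, h1]
      _ ≤ (p : ℝ) ^ (d + 2) * ρ ^ d := by gcongr
      _ = ((p : ℝ) * ρ ^ d) * (p : ℝ) ^ (d + 1) := by ring
  calc (p : ℝ) ^ (d + 2) * c₀ ^ d / (n : ℝ) ^ (2 * (d - 1) * d)
      ≤ ((p : ℝ) * ρ ^ d) * (p : ℝ) ^ (d + 1) := hmain
    _ ≤ μ.real (siteConnIn (zdGraph d) ↑(box d (2 * n)) x z) *
          μ.real (siteConnIn (zdGraph d) ↑(box d (2 * n)) z y) :=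
        mul_le_mul hleg1 hleg2 (by positivity) measureReal_nonneg
    _ ≤ μ.real (siteConnIn (zdGraph d) ↑(box d (2 * n)) x y) := hglue

/-! ### F. The recursion of §8–§9 from a connection lower bound (Cerf 2015, verbatim) -/

/-- **Cerf 2015, the recursive inequality of §8–§9 at a parameter `p ∈ (0,1)` satisfying the
conclusion of Lemma 6.1** (p. 13 last display / p. 14 first display): there is `c = c(d, p)` with
`P(two-arms(0, 3n)) ≤ (c ln n/√n) (k^{−(d−1)} + k^{2d²+2d−2} P(two-arms(0, n−k−2)))^{1/2}` for
`n ≥ 2`, `1 ≤ k ≤ n − 3` (range and radius as in `Cerf2015_sec9_recursion`,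
`CerfCentralInequality.lean`). Inputs: Lemma 5.1 with `ℓ = n`, the covering of `∂ⁱⁿΛ(n+1)` by
translates of `Λ(k)`, Cor. 7.2, the connection bound, `E(√|𝒞|) ≤ E(|𝒞|)^{1/2}`. This is the
proof of `Cerf2015_sec9_recursion_of_lemmas` (`CerfSec8Proofs.lean`) with its only use of
`θ(p) > 0` — the connection lower bound of Lemma 6.1 — turned into a hypothesis, so that it
runs at `p_c` (§9, p. 14: "In this section, we work at `p = p_c`"). [cite: Cerf2015, §8–§9 (p. 12–14)] -/
theorem sec9_recursion_of_connBound (h51 : Cerf2015_lem_5_1) (h72 : Cerf2015_cor_7_2)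
    (hd : 2 ≤ d) (p : unitInterval) (hp0 : 0 < (p : ℝ)) (hp1 : (p : ℝ) < 1)
    (h6' : ∃ c : ℝ, 0 < c ∧ ∀ n : ℕ, 1 ≤ n → ∀ x ∈ box d n, ∀ y ∈ box d n,
      c / (n : ℝ) ^ (2 * (d - 1) * d) ≤
        (sitePercolation (Site d) p).real (siteConnIn (zdGraph d) ↑(box d (2 * n)) x y)) :
    ∃ c : ℝ, ∀ n k : ℕ, 2 ≤ n → 1 ≤ k → k + 3 ≤ n →
      (sitePercolation (Site d) p).real (siteTwoArms d 0 (3 * n)) ≤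
        c * Real.log n / Real.sqrt n *
          Real.sqrt (1 / (k : ℝ) ^ (d - 1) + (k : ℝ) ^ (2 * d ^ 2 + 2 * d - 2) *
            (sitePercolation (Site d) p).real (siteTwoArms d 0 (n - k - 2))) := by
  have hd1 : 1 ≤ d := by omega
  obtain ⟨C₇, hC₇⟩ := h72 d hd p hp0 hp1
  obtain ⟨c₆, hc₆, h6⟩ := h6'
  -- the constants
  set C₇' : ℝ := max C₇ 1 with hC₇'
  have hC₇'pos : 0 < C₇' := lt_of_lt_of_le one_pos (le_max_right _ _)
  set D : ℝ := 2 * d * 3 ^ (d - 1) * C₇' / c₆ with hD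
  have hD0 : 0 ≤ D := by positivity
  set c₃ : ℝ := 2 * d * 6 ^ (d - 1) * (1 + D) with hc₃
  have hc₃pos : 0 < c₃ := by positivity
  set a : ℝ := (p : ℝ) ^ 2 * (1 - p) ^ 2 with ha
  have h1p : 0 < 1 - (p : ℝ) := by linarith
  have hapos : 0 < a := by positivity
  set CT : ℝ := 4 * d / ((p : ℝ) * (1 - p)) *
    (16 ^ d * Real.exp (((3 * d : ℕ) : ℝ) ^ 2 / (8 * a))) with hCT
  have hCT0 : 0 ≤ CT := by positivity
  refine ⟨2 * d * Real.sqrt c₃ + CT / Real.log 2, ?_⟩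
  intro n k hn hk hkn
  have hn1 : 1 ≤ n := by omega
  have hn0 : (0 : ℝ) < n := by positivity
  have hk0 : (0 : ℝ) < k := by exact_mod_cast hk
  -- abbreviations
  set P2 : ℝ := (sitePercolation (Site d) p).real (siteTwoArms d 0 (n - k - 2)) with hP2
  have hP2nn : 0 ≤ P2 := measureReal_nonneg
  set e : ℕ := 2 * d ^ 2 + 2 * d - 2 with he
  set Q : ℝ := 1 / (k : ℝ) ^ (d - 1) + (k : ℝ) ^ e * P2 with hQ
  have hQpos : 0 < Q := by positivity
  -- Cor. 7.2 and Lemma 6.1 for the bad boxes: `q ≤ (C₇'/c₆) k^e P(two-arms(0, n-k-2))`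
  set q : ℝ := (sitePercolation (Site d) p).real (siteTwoArmsBox d k (n - 1)) with hq
  have hq0 : 0 ≤ q := measureReal_nonneg
  have h6k : ∀ a ∈ innerBoundary (zdGraph d) (box d k), ∀ b ∈ innerBoundary (zdGraph d) (box d k),
      c₆ / (k : ℝ) ^ (2 * (d - 1) * d) ≤
        (sitePercolation (Site d) p).real (siteConnIn (zdGraph d) ↑(box d (2 * k)) a b) :=
    fun a ha b hb => h6 k hk a (mem_innerBoundary_iff.1 ha).1 b (mem_innerBoundary_iff.1 hb).1
  have h72k := hC₇ k hk (n - 1) (by omega) _ h6k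
  rw [show n - 1 - k - 1 = n - k - 2 by omega] at h72k
  have hpow : (k : ℝ) ^ (4 * d - 2) * (k : ℝ) ^ (2 * (d - 1) * d) = (k : ℝ) ^ e := by
    rw [← pow_add, cerf_exponent_eq hd1]
  have hq_le : q ≤ C₇' / c₆ * (k : ℝ) ^ e * P2 := by
    have hkpow : (0 : ℝ) < (k : ℝ) ^ (2 * (d - 1) * d) := by positivity
    have h1 : q * c₆ ≤ C₇' * (k : ℝ) ^ e * P2 :=
      calc q * c₆ = q * (c₆ / (k : ℝ) ^ (2 * (d - 1) * d)) * (k : ℝ) ^ (2 * (d - 1) * d) := by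
            field_simp
        _ ≤ C₇ * (k : ℝ) ^ (4 * d - 2) *
              (sitePercolation (Site d) p).real (siteTwoArms d 0 (n - k - 2)) *
              (k : ℝ) ^ (2 * (d - 1) * d) :=
            mul_le_mul_of_nonneg_right h72k hkpow.le
        _ ≤ C₇' * (k : ℝ) ^ (4 * d - 2) * P2 * (k : ℝ) ^ (2 * (d - 1) * d) := by
            gcongr
            exact le_max_left _ _
        _ = C₇' * ((k : ℝ) ^ (4 * d - 2) * (k : ℝ) ^ (2 * (d - 1) * d)) * P2 := by ring
        _ = C₇' * (k : ℝ) ^ e * P2 := by rw [hpow]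
    rw [show C₇' / c₆ * (k : ℝ) ^ e * P2 = C₇' * (k : ℝ) ^ e * P2 / c₆ by ring, le_div_iff₀ hc₆]
    exact h1
  -- the covering of `∂ⁱⁿΛ(n+1)` by translates of `Λ(k)` and the pointwise bound on `|𝒞|`
  obtain ⟨I, hIbox, hcov, hIcard⟩ := exists_boxCovering hd1 (N := n + 1) (k := k) hk (by omega)
  have hIW : ∀ v ∈ I, shiftedBox v (k + (n - 1)) ⊆ box d (n + n) := by
    intro v hv
    have h := shiftedBox_subset_box (m := k + (n - 1)) (hIbox v hv)
    rwa [show n + 1 - k + (k + (n - 1)) = n + n by omega] at h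
  have hΛL : box d (n + 1) ⊆ box d (n + n) := box_mono d (by omega)
  have hptw := card_reachingClusters_le hΛL hIW hcov
  set K : ℕ := #(innerBoundary (zdGraph d) (box d k)) with hK
  -- sizes: `|I| ≤ 2d 6^{d-1} n^{d-1}/k^{d-1}`, `K ≤ 2d 3^{d-1} k^{d-1}`
  have hn1r : (1 : ℝ) ≤ n := by exact_mod_cast hn1
  have hk1r : (1 : ℝ) ≤ k := by exact_mod_cast hk
  have hIle : (#I : ℝ) ≤ 2 * d * 6 ^ (d - 1) * (n : ℝ) ^ (d - 1) / (k : ℝ) ^ (d - 1) := by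
    calc (#I : ℝ) ≤ 2 * d * (3 * ((n + 1 : ℕ) : ℝ) / k) ^ (d - 1) := hIcard
      _ ≤ 2 * d * (6 * (n : ℝ) / k) ^ (d - 1) := by
          push_cast
          have h36 : 3 * ((n : ℝ) + 1) / k ≤ 6 * (n : ℝ) / k :=
            div_le_div_of_nonneg_right (by linarith) hk0.le
          exact mul_le_mul_of_nonneg_left (pow_le_pow_left₀ (by positivity) h36 _)
            (by positivity)
      _ = 2 * d * 6 ^ (d - 1) * (n : ℝ) ^ (d - 1) / (k : ℝ) ^ (d - 1) := by
          rw [div_pow, mul_pow]; ring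
  have hKle : (K : ℝ) ≤ 2 * d * 3 ^ (d - 1) * (k : ℝ) ^ (d - 1) := by
    have h := card_innerBoundary_box_le (d := d) k
    calc (K : ℝ) ≤ ((2 * d * (2 * k + 1) ^ (d - 1) : ℕ) : ℝ) := by exact_mod_cast h
      _ = 2 * d * (2 * (k : ℝ) + 1) ^ (d - 1) := by push_cast; ring
      _ ≤ 2 * d * (3 * (k : ℝ)) ^ (d - 1) := by
          gcongr
          linarith
      _ = 2 * d * 3 ^ (d - 1) * (k : ℝ) ^ (d - 1) := by rw [mul_pow]; ring
  have hKq : (K : ℝ) * q ≤ D * (k : ℝ) ^ (d - 1) * ((k : ℝ) ^ e * P2) :=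
    calc (K : ℝ) * q ≤ (2 * d * 3 ^ (d - 1) * (k : ℝ) ^ (d - 1)) * (C₇' / c₆ * (k : ℝ) ^ e * P2) :=
          mul_le_mul hKle hq_le hq0 (by positivity)
      _ = D * (k : ℝ) ^ (d - 1) * ((k : ℝ) ^ e * P2) := by simp only [hD]; ring
  have hAB : (#I : ℝ) + K * (#I * q) ≤ c₃ * (n : ℝ) ^ (d - 1) * Q := by
    have hkp : (0 : ℝ) < (k : ℝ) ^ (d - 1) := by positivity
    have hX : 0 ≤ (k : ℝ) ^ e * P2 := by positivity
    have hu : 0 ≤ D * (1 / (k : ℝ) ^ (d - 1)) := by positivity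
    calc (#I : ℝ) + K * (#I * q) = #I * (1 + K * q) := by ring
      _ ≤ (2 * d * 6 ^ (d - 1) * (n : ℝ) ^ (d - 1) / (k : ℝ) ^ (d - 1)) *
            (1 + D * (k : ℝ) ^ (d - 1) * ((k : ℝ) ^ e * P2)) :=
          mul_le_mul hIle (by linarith [hKq]) (by positivity) (by positivity)
      _ = 2 * d * 6 ^ (d - 1) * (n : ℝ) ^ (d - 1) *
            (1 / (k : ℝ) ^ (d - 1) + D * ((k : ℝ) ^ e * P2)) := by
          field_simp
      _ ≤ 2 * d * 6 ^ (d - 1) * (n : ℝ) ^ (d - 1) * ((1 + D) * Q) := by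
          apply mul_le_mul_of_nonneg_left _ (by positivity)
          simp only [hQ]
          nlinarith [hu, hX]
      _ = c₃ * (n : ℝ) ^ (d - 1) * Q := by simp only [hc₃]; ring
  -- `E(√|𝒞|) ≤ (c₃ n^{d-1} Q)^{1/2}` (translation invariance for the bad boxes)
  have hint : ∫ ω, Real.sqrt
      ((reachingClusters (zdGraph d) (box d (n + n)) (box d (n + 1)) ω).card : ℝ)
        ∂(sitePercolation (Site d) p) ≤ Real.sqrt (c₃ * (n : ℝ) ^ (d - 1) * Q) := by
    refine integral_sqrt_le_sqrt_of_le_indicator_sum (sitePercolation (Site d) p) I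
      (fun v => SiteConfig.relabel (zdShiftIso (-v)).toEquiv ⁻¹' siteTwoArmsBox d k (n - 1))
      (fun ω => ((reachingClusters (zdGraph d) (box d (n + n)) (box d (n + 1)) ω).card : ℝ))
      (fun ω => Nat.cast_nonneg _) (Nat.cast_nonneg K) hptw ?_ (by positivity) hAB
    intro v _
    exact sitePercolation_real_preimage_relabel _ p _
  -- Lemma 5.1 with `ℓ = n` and the two terms
  have h51n := h51 d hd p hp0 hp1 n n hn1 (by omega)
  rw [show 2 * n + n = 3 * n by ring] at h51n
  have hlog0 : 0 ≤ Real.log n := Real.log_nonneg hn1r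
  have hT1 : 2 * d * Real.log n / Real.sqrt ((box d n).card : ℝ) *
      ∫ ω, Real.sqrt ((reachingClusters (zdGraph d) (box d (n + n)) (box d (n + 1)) ω).card : ℝ)
        ∂(sitePercolation (Site d) p) ≤
      2 * d * Real.sqrt c₃ * Real.log n / Real.sqrt n * Real.sqrt Q :=
    calc _ ≤ 2 * d * Real.log n / Real.sqrt ((box d n).card : ℝ) *
          Real.sqrt (c₃ * (n : ℝ) ^ (d - 1) * Q) :=
          mul_le_mul_of_nonneg_left hint (by positivity)
      _ ≤ _ := first_term_le hd1 Q hc₃pos.le hn1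
  have hT2 : 4 * d / ((p : ℝ) * (1 - p)) * ((box d (n + 1)).card : ℝ) ^ 2 *
      Real.exp (-2 * Real.log n ^ 2 * (p : ℝ) ^ 2 * (1 - p) ^ 2) ≤
      CT / Real.log 2 * Real.log n / Real.sqrt n * Real.sqrt Q := by
    have hexp : Real.exp (-2 * Real.log n ^ 2 * (p : ℝ) ^ 2 * (1 - p) ^ 2) =
        Real.exp (-2 * Real.log n ^ 2 * a) := by
      simp only [ha]; ring_nf
    have h2 := card_box_sq_mul_exp_le (d := d) hapos hn
    calc 4 * d / ((p : ℝ) * (1 - p)) * ((box d (n + 1)).card : ℝ) ^ 2 *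
          Real.exp (-2 * Real.log n ^ 2 * (p : ℝ) ^ 2 * (1 - p) ^ 2)
        = 4 * d / ((p : ℝ) * (1 - p)) *
            (((box d (n + 1)).card : ℝ) ^ 2 * Real.exp (-2 * Real.log n ^ 2 * a)) := by
          rw [hexp]; ring
      _ ≤ 4 * d / ((p : ℝ) * (1 - p)) *
            (16 ^ d * Real.exp (((3 * d : ℕ) : ℝ) ^ 2 / (8 * a)) / (n : ℝ) ^ d) :=
          mul_le_mul_of_nonneg_left h2 (by positivity)
      _ = CT / (n : ℝ) ^ d := by simp only [hCT]; ring
      _ ≤ CT / Real.log 2 * Real.log n / Real.sqrt n * Real.sqrt Q := by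
          simp only [hQ]
          exact div_pow_le_log_div_sqrt_mul_sqrt hd1 hCT0 (by positivity) hn hk (by omega)
  calc (sitePercolation (Site d) p).real (siteTwoArms d 0 (3 * n)) ≤ _ := h51n
    _ ≤ 2 * d * Real.sqrt c₃ * Real.log n / Real.sqrt n * Real.sqrt Q +
          CT / Real.log 2 * Real.log n / Real.sqrt n * Real.sqrt Q := add_le_add hT1 hT2
    _ = (2 * d * Real.sqrt c₃ + CT / Real.log 2) * Real.log n / Real.sqrt n * Real.sqrt Q := by
        ring

/-! ### G. Theorem 1.1 at `p_c` -/

/-- At `p = 0` every site is closed almost surely, so the two-arms event — which requires open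
neighbours of the origin — is null. [folklore] -/
theorem real_siteTwoArms_bot (n : ℕ) :
    (sitePercolation (Site d) 0).real (siteTwoArms d 0 n) = 0 := by
  have hx : (∅ : SiteConfig (Site d)) ∉ siteTwoArms d 0 n := by
    rintro ⟨y, z, -, -, -, ⟨w, -, hw⟩, -⟩
    exact (mem_open_of_mem_siteClusterIn hw).1
  simp only [sitePercolation, ProbabilityTheory.setBernoulli_zero, measureReal_def,
    Measure.dirac_apply, Set.indicator_of_notMem hx, ENNReal.toReal_zero]

/-- **Cerf 2015, Theorem 1.1, discharged**: for `d ≥ 2` and every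
`γ < γ_∞(d) = (2d²+3d−3)/(4d²+5d−5)` there is `c` with `P_{p_c}(two-arms(0,n)) ≤ c n^{−γ}` for all
`n ≥ 1` (the vendored reading of "`limsup (1/ln n) ln P_{p_c}(two-arms(0,n)) ≤ −γ_∞`", see
`CerfTwoArms.lean`). Proof as printed (§9 at `p = p_c`): the recursion of §8–§9
(`sec9_recursion_of_connBound`, from Lemma 5.1 = `Cerf2015_lem_5_1_holds`, Cor. 7.2 =
`Cerf2015_cor_7_2_holds` and Lemma 6.1 at `p_c` = `lem_6_1_of_bound` fed with the Hammersley
input `exists_innerBoundary_siteConnIn_ge_criticalProb`), then the exponent iteration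
`exponent_iteration` started from the trivial bound. The degenerate values `p_c ∈ {0, 1}` (not
excluded by the definition `siteCriticalProb`, and under which the printed proof's standing
assumption `p ∈ ]0,1[` fails) make the two-arms event null, so the bound holds with `c = 0`.
[cite: Cerf2015, Thm 1.1 (proof: §9, p. 14)] -/
theorem Cerf2015_thm_1_1_holds : Cerf2015_thm_1_1 := by
  intro d hd γ hγ
  set p := siteCriticalProbI d with hp
  set μ := sitePercolation (Site d) p with hμ
  rcases eq_or_lt_of_le p.2.2 with hp1 | hp1
  · -- `p_c = 1`: the event is null
    refine ⟨0, fun n _ => ?_⟩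
    have h := real_siteTwoArms_le_one_sub (d := d) p n
    rw [hp1, sub_self] at h
    rw [zero_mul]; exact h
  rcases eq_or_lt_of_le p.2.1 with hp0 | hp0
  · -- `p_c = 0`: the event is null
    refine ⟨0, fun n _ => ?_⟩
    have hp0' : p = 0 := Subtype.ext hp0.symm
    rw [zero_mul, hμ, hp0', real_siteTwoArms_bot]
  -- `0 < p_c < 1`: Lemma 6.1 at `p_c` from the Hammersley input, the recursion, the iteration
  have hκ : ∀ m : ℕ, 1 ≤ m → ∃ b ∈ innerBoundary (zdGraph d) (box d m),
      (p : ℝ) / (2 * d * (2 * m + 1) ^ (d - 1)) ≤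
        μ.real (siteConnIn (zdGraph d) ↑(box d m) 0 b) :=
    fun m hm => exists_innerBoundary_siteConnIn_ge_criticalProb hp0 hp1 hm
  have h6 := lem_6_1_of_bound hd p hp0 hp0 (le_of_lt hp1) hκ
  obtain ⟨c, hc⟩ := sec9_recursion_of_connBound Cerf2015_lem_5_1_holds Cerf2015_cor_7_2_holds
    hd p hp0 hp1 h6
  have hd1 : 1 ≤ d := le_trans one_le_two hd
  have h2 : 2 ≤ 2 * d ^ 2 + 2 * d := by nlinarith
  have hP0 : ∀ n, 0 ≤ μ.real (siteTwoArms d 0 n) := fun n => measureReal_nonneg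
  have hP1 : ∀ n, μ.real (siteTwoArms d 0 n) ≤ 1 := fun n => measureReal_le_one
  have hanti : ∀ m n : ℕ, 1 ≤ m → m ≤ n →
      μ.real (siteTwoArms d 0 n) ≤ μ.real (siteTwoArms d 0 m) := fun m n hm hmn =>
    measureReal_mono (siteTwoArms_antitone hm hmn) (measure_ne_top _ _)
  have hexp : (((d - 1 : ℕ) : ℝ) + ((2 * d ^ 2 + 2 * d - 2 : ℕ) : ℝ)) /
      (((d - 1 : ℕ) : ℝ) + 2 * ((2 * d ^ 2 + 2 * d - 2 : ℕ) : ℝ)) = cerfTwoArmsExponent d := by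
    rw [Nat.cast_sub hd1, Nat.cast_sub h2]
    unfold cerfTwoArmsExponent
    push_cast
    ring_nf
  have hγ' : γ < (((d - 1 : ℕ) : ℝ) + ((2 * d ^ 2 + 2 * d - 2 : ℕ) : ℝ)) /
      (((d - 1 : ℕ) : ℝ) + 2 * ((2 * d ^ 2 + 2 * d - 2 : ℕ) : ℝ)) := by rwa [hexp]
  exact exponent_iteration (P := fun n => μ.real (siteTwoArms d 0 n)) (by omega) (by omega)
    hP0 hP1 hanti hc hγ'

end CritPerc

end Literature.Probability.Percolation
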